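/-
Copyright (c) 2026. All rights reserved.
Released under Apache 2.0 license as described in the file LICENSE.
Authors: HodgeCM publication cell (pub/hodgecm-mathlib), Track B, seat K2E3-p25 (g0).
-/
import Summits.HodgeConjecture.HodgeConjecture.Theorems.K2E3GL3BorelUnipotentHaar          -- ★ `mem_borelUnipotentGL3_iff`, `exists_coordHomeomorph`, `coord_mul`
import Summits.HodgeConjecture.HodgeConjecture.Theorems.K2E3BorelCellJacquetLine           -- ★ E3γ2 `eq_one_of_mem_borel_of_mem_lower` (and the cell-datum currency)
import Literature.NumberTheory.Automorphic.InducedWhittakerVanishing                       -- ★ `coe_permGL_mul_mul_inv`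
import Literature.NumberTheory.Automorphic.GLnCongruenceSubgroups                          -- ★ `mem_unipotentRadicalGL_iff_apply`
import Literature.NumberTheory.Automorphic.GLnTwoBlockLeviStructure                        -- ★ `mem_standardLeviGL_iff`
import HarnessLib

/-!
# K2_E3 road (h413), leaf (nsc-S-A′), brick E3β₁ — the six Bruhat cells of `GL₃`: cell data `(S_w, Γ_w, proj_w)` (pure group theory)
Cell `pub/hodgecm-mathlib` (D-0151), Track B, seat K2E3-p25 (g0).  `--supports stmt-HodgeConjecture-24833 --as helper`; THEOREMS ONLY; COUNT-NEUTRAL.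
For each `w ∈ S₃` (tree convention `(P_w)_{ij} = [w i = j]`, cell `B P_w U`, `(P_w g P_w⁻¹)_{ij} = g_{w i, w j}`) the CELL DATUM of ★ E3γ1∕E3γ2: `Γ_w = ∏_{a<b, w⁻¹a > w⁻¹b} U_{ab}`
(so `P_w Γ_w P_w⁻¹ ⊆ U⁻`), `S_w = ∏_{a<b, w⁻¹a<w⁻¹b} U_{ab} = {u ∈ U : P_w u P_w⁻¹ ∈ B}`, `U = S_w Γ_w`, and a continuous retraction `proj_w : U → Γ_w` with `proj_w(sγ) = γ`:
`e ↦ (U, 1)`, `s₁ = (01) ↦ (U_Q, U_{α₁})`, `s₂ = (12) ↦ (U_{Q′}, U_{α₂})`, `s₁s₂ ↦ (U_{α₂}, U_{Q′})`, `s₂s₁ ↦ (U_{α₁}, U_Q)`, `w₀ ↦ (1, U)`; here `U_Q = unipotentRadicalGL F ![f,f,t]`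
(roots (0,2),(1,2)), `U_{Q′} = unipotentRadicalGL F ![f,t,t]` (roots (0,1),(0,2)), `U_{α₁} = U_{Q′} ⊓ M_Q`, `U_{α₂} = U_Q ⊓ M_{Q′}`.  Elements are written in the ★ coordinates
`e((x,y),z) = [[1,x,z],[0,1,y],[0,0,1]]` of `K2E3GL3BorelUnipotentHaar`.
HONEST LABEL: HC_CM is proved only modulo the 7 printed citations (2 remaining named inputs: hLiu418 = stmt-HodgeConjecture-24832, h413 = stmt-HodgeConjecture-24833) until rung 0 closes.
## References
* [BernsteinZelevinsky1977] I. N. Bernstein, A. V. Zelevinsky, *Induced representations of reductive p-adic groups I*, Ann. Sci. ÉNS 10 (1977), §2.1, Thm. 5.2 (geometric lemma).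
* [Casselman1995] W. Casselman, *Introduction to the theory of admissible representations of p-adic reductive groups* (draft 1995), §6.3 (Prop. 6.3.1–6.3.3: `U = U_w U^w`).
-/

set_option autoImplicit false
set_option linter.dupNamespace false

noncomputable section

open Set Function
open scoped MatrixGroups

namespace Summit.HodgeConjecture.HodgeConjecture.Cruxes.H413.K2E3GL3BruhatCellSubgroups

open Literature.NumberTheory.Automorphic
open Summit.HodgeConjecture.HodgeConjecture.Cruxes.H413.K2E3GL3BorelUnipotentHaar

variable {F : Type*} [Field F]

/-! ## §1 Entrywise membership criteria in `GL₃` -/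

/-- Entries of a conjugate by a permutation matrix: `(P_w g P_w⁻¹)_{ij} = g_{w i, w j}`. [folklore] -/
theorem permGL_conj_apply (w : Equiv.Perm (Fin 3)) (g : GL (Fin 3) F) (i j : Fin 3) :
    (((permGL w : GL (Fin 3) F) * g * (permGL w)⁻¹ : GL (Fin 3) F) : Matrix (Fin 3) (Fin 3) F) i j = (g : Matrix (Fin 3) (Fin 3) F) (w i) (w j) := by
  rw [coe_permGL_mul_mul_inv, Matrix.submatrix_apply]

/-- `g ∈ U` (upper unitriangular) iff `g₁₀ = g₂₀ = g₂₁ = 0` and `g₀₀ = g₁₁ = g₂₂ = 1`. [folklore] -/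
theorem mem_upperUnitriangular_three_iff (g : GL (Fin 3) F) :
    g ∈ upperUnitriangular (Fin 3) F ↔
      (g : Matrix (Fin 3) (Fin 3) F) 1 0 = 0 ∧ (g : Matrix (Fin 3) (Fin 3) F) 2 0 = 0 ∧ (g : Matrix (Fin 3) (Fin 3) F) 2 1 = 0 ∧
      (g : Matrix (Fin 3) (Fin 3) F) 0 0 = 1 ∧ (g : Matrix (Fin 3) (Fin 3) F) 1 1 = 1 ∧ (g : Matrix (Fin 3) (Fin 3) F) 2 2 = 1 := by
  rw [upperUnitriangular, mem_unipotentRadicalGL_iff_apply]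
  constructor
  · intro h
    exact ⟨by simpa using h 1 0 (by decide), by simpa using h 2 0 (by decide), by simpa using h 2 1 (by decide),
      by simpa using h 0 0 le_rfl, by simpa using h 1 1 le_rfl, by simpa using h 2 2 le_rfl⟩
  · rintro ⟨h10, h20, h21, h00, h11, h22⟩ i j hij
    fin_cases i <;> fin_cases j <;> simp_all (config := {decide := true})

/-- `g ∈ B` (upper triangular) iff `g₁₀ = g₂₀ = g₂₁ = 0`. [folklore] -/
theorem mem_borel_three_iff (g : GL (Fin 3) F) :
    g ∈ standardParabolicGL F (id : Fin 3 → Fin 3) ↔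
      (g : Matrix (Fin 3) (Fin 3) F) 1 0 = 0 ∧ (g : Matrix (Fin 3) (Fin 3) F) 2 0 = 0 ∧ (g : Matrix (Fin 3) (Fin 3) F) 2 1 = 0 := by
  rw [mem_standardParabolicGL_iff]
  constructor
  · intro h
    exact ⟨h (show (id 0 : Fin 3) < id 1 by decide), h (show (id 0 : Fin 3) < id 2 by decide), h (show (id 1 : Fin 3) < id 2 by decide)⟩
  · rintro ⟨h10, h20, h21⟩ i j hij
    fin_cases i <;> fin_cases j <;> simp_all (config := {decide := true})

/-- `g ∈ U⁻ = unipotentRadicalGL F (toDual ∘ id)` (lower unitriangular) iff its diagonal is `1` and `g₀₁ = g₀₂ = g₁₂ = 0`. [folklore] -/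
theorem mem_lowerUnitriangular_three_iff (g : GL (Fin 3) F) :
    g ∈ unipotentRadicalGL F (⇑OrderDual.toDual ∘ (id : Fin 3 → Fin 3)) ↔
      (g : Matrix (Fin 3) (Fin 3) F) 0 1 = 0 ∧ (g : Matrix (Fin 3) (Fin 3) F) 0 2 = 0 ∧ (g : Matrix (Fin 3) (Fin 3) F) 1 2 = 0 ∧
      (g : Matrix (Fin 3) (Fin 3) F) 0 0 = 1 ∧ (g : Matrix (Fin 3) (Fin 3) F) 1 1 = 1 ∧ (g : Matrix (Fin 3) (Fin 3) F) 2 2 = 1 := by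
  rw [mem_unipotentRadicalGL_iff_apply]
  simp only [Function.comp_apply, id_eq, OrderDual.toDual_le_toDual]
  constructor
  · intro h
    exact ⟨by simpa using h 0 1 (by decide), by simpa using h 0 2 (by decide), by simpa using h 1 2 (by decide),
      by simpa using h 0 0 le_rfl, by simpa using h 1 1 le_rfl, by simpa using h 2 2 le_rfl⟩
  · rintro ⟨h01, h02, h12, h00, h11, h22⟩ i j hij
    fin_cases i <;> fin_cases j <;> simp_all (config := {decide := true})

/-- `g ∈ U_Q = unipotentRadicalGL F ![f,f,t]` (root groups (0,2),(1,2)) iff `g ∈ U` and `g₀₁ = 0`. [cite: BernsteinZelevinsky1977, §2.1] -/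
theorem mem_unipotentRadicalGL_twoOne_iff (g : GL (Fin 3) F) :
    g ∈ unipotentRadicalGL F (![false, false, true] : Fin 3 → Bool) ↔ g ∈ upperUnitriangular (Fin 3) F ∧ (g : Matrix (Fin 3) (Fin 3) F) 0 1 = 0 := by
  rw [mem_upperUnitriangular_three_iff, mem_unipotentRadicalGL_iff_apply]
  constructor
  · intro h
    exact ⟨⟨by simpa using h 1 0 (by decide), by simpa using h 2 0 (by decide), by simpa using h 2 1 (by decide),
      by simpa using h 0 0 le_rfl, by simpa using h 1 1 le_rfl, by simpa using h 2 2 le_rfl⟩, by simpa using h 0 1 (by decide)⟩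
  · rintro ⟨⟨h10, h20, h21, h00, h11, h22⟩, h01⟩ i j hij
    fin_cases i <;> fin_cases j <;> simp_all (config := {decide := true})

/-- `g ∈ U_{Q′} = unipotentRadicalGL F ![f,t,t]` (root groups (0,1),(0,2)) iff `g ∈ U` and `g₁₂ = 0`. [cite: BernsteinZelevinsky1977, §2.1] -/
theorem mem_unipotentRadicalGL_oneTwo_iff (g : GL (Fin 3) F) :
    g ∈ unipotentRadicalGL F (![false, true, true] : Fin 3 → Bool) ↔ g ∈ upperUnitriangular (Fin 3) F ∧ (g : Matrix (Fin 3) (Fin 3) F) 1 2 = 0 := by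
  rw [mem_upperUnitriangular_three_iff, mem_unipotentRadicalGL_iff_apply]
  constructor
  · intro h
    exact ⟨⟨by simpa using h 1 0 (by decide), by simpa using h 2 0 (by decide), by simpa using h 2 1 (by decide),
      by simpa using h 0 0 le_rfl, by simpa using h 1 1 le_rfl, by simpa using h 2 2 le_rfl⟩, by simpa using h 1 2 (by decide)⟩
  · rintro ⟨⟨h10, h20, h21, h00, h11, h22⟩, h12⟩ i j hij
    fin_cases i <;> fin_cases j <;> simp_all (config := {decide := true})

/-- The root group `U_{α₁} = U_{Q′} ⊓ M_Q` (position (0,1)): `g ∈ U_{α₁}` iff `g ∈ U`, `g₁₂ = 0`, `g₀₂ = 0`. [cite: BernsteinZelevinsky1977, §2.1] -/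
theorem mem_rootGroup_zeroOne_iff (g : GL (Fin 3) F) :
    g ∈ unipotentRadicalGL F (![false, true, true] : Fin 3 → Bool) ⊓ standardLeviGL F (![false, false, true] : Fin 3 → Bool) ↔
      g ∈ upperUnitriangular (Fin 3) F ∧ (g : Matrix (Fin 3) (Fin 3) F) 1 2 = 0 ∧ (g : Matrix (Fin 3) (Fin 3) F) 0 2 = 0 := by
  rw [Subgroup.mem_inf, mem_unipotentRadicalGL_oneTwo_iff, mem_standardLeviGL_iff, mem_upperUnitriangular_three_iff]
  constructor
  · rintro ⟨⟨hU, h12⟩, hM⟩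
    exact ⟨hU, h12, hM 0 2 (by decide)⟩
  · rintro ⟨⟨h10, h20, h21, h00, h11, h22⟩, h12, h02⟩
    refine ⟨⟨⟨h10, h20, h21, h00, h11, h22⟩, h12⟩, fun i j hij => ?_⟩
    fin_cases i <;> fin_cases j <;> simp_all (config := {decide := true})

/-- The root group `U_{α₂} = U_Q ⊓ M_{Q′}` (position (1,2)): `g ∈ U_{α₂}` iff `g ∈ U`, `g₀₁ = 0`, `g₀₂ = 0`. [cite: BernsteinZelevinsky1977, §2.1] -/
theorem mem_rootGroup_oneTwo_iff (g : GL (Fin 3) F) :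
    g ∈ unipotentRadicalGL F (![false, false, true] : Fin 3 → Bool) ⊓ standardLeviGL F (![false, true, true] : Fin 3 → Bool) ↔
      g ∈ upperUnitriangular (Fin 3) F ∧ (g : Matrix (Fin 3) (Fin 3) F) 0 1 = 0 ∧ (g : Matrix (Fin 3) (Fin 3) F) 0 2 = 0 := by
  rw [Subgroup.mem_inf, mem_unipotentRadicalGL_twoOne_iff, mem_standardLeviGL_iff, mem_upperUnitriangular_three_iff]
  constructor
  · rintro ⟨⟨hU, h01⟩, hM⟩
    exact ⟨hU, h01, hM 0 2 (by decide)⟩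
  · rintro ⟨⟨h10, h20, h21, h00, h11, h22⟩, h01, h02⟩
    refine ⟨⟨⟨h10, h20, h21, h00, h11, h22⟩, h01⟩, fun i j hij => ?_⟩
    fin_cases i <;> fin_cases j <;> simp_all (config := {decide := true})

/-! ## §2 Coordinates `e((x,y),z) = [[1,x,z],[0,1,y],[0,0,1]]` (★ `exists_coordHomeomorph`): entries and membership -/

section Coord

variable [TopologicalSpace F] [IsTopologicalRing F]
  (e : (F × F) × F ≃ₜ ↥(unipotentRadicalGL F (id : Fin 3 → Fin 3)))
  (he : ∀ p : (F × F) × F, (((e p : ↥(unipotentRadicalGL F (id : Fin 3 → Fin 3))) : GL (Fin 3) F) : Matrix (Fin 3) (Fin 3) F) = !![1, p.1.1, p.2; 0, 1, p.1.2; 0, 0, 1])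
include he

omit [IsTopologicalRing F] in
/-- The off-diagonal entries of `e((x,y),z)`: `(0,1) ↦ x`, `(1,2) ↦ y`, `(0,2) ↦ z`. [folklore] -/
theorem coord_apply (p : (F × F) × F) :
    (((e p : ↥(unipotentRadicalGL F (id : Fin 3 → Fin 3))) : GL (Fin 3) F) : Matrix (Fin 3) (Fin 3) F) 0 1 = p.1.1 ∧
    (((e p : ↥(unipotentRadicalGL F (id : Fin 3 → Fin 3))) : GL (Fin 3) F) : Matrix (Fin 3) (Fin 3) F) 1 2 = p.1.2 ∧
    (((e p : ↥(unipotentRadicalGL F (id : Fin 3 → Fin 3))) : GL (Fin 3) F) : Matrix (Fin 3) (Fin 3) F) 0 2 = p.2 := by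
  rw [he]; simp

omit [IsTopologicalRing F] in
/-- Every `u ∈ U` is `e((u₀₁, u₁₂), u₀₂)`. [folklore] -/
theorem eq_coord (u : GL (Fin 3) F) (hu : u ∈ upperUnitriangular (Fin 3) F) :
    u = ((e (Prod.mk (Prod.mk ((u : Matrix (Fin 3) (Fin 3) F) 0 1) ((u : Matrix (Fin 3) (Fin 3) F) 1 2)) ((u : Matrix (Fin 3) (Fin 3) F) 0 2)) :
      ↥(unipotentRadicalGL F (id : Fin 3 → Fin 3))) : GL (Fin 3) F) := by
  set q := e.symm ⟨u, hu⟩ with hq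
  have hu' : u = ((e q : ↥(unipotentRadicalGL F (id : Fin 3 → Fin 3))) : GL (Fin 3) F) := by
    rw [hq, Homeomorph.apply_symm_apply]
  obtain ⟨h1, h2, h3⟩ := coord_apply e he q
  rw [← hu'] at h1 h2 h3
  rw [h1, h2, h3]
  exact hu'

omit [IsTopologicalRing F] in
/-- Coordinates of the four root subgroups: `e p ∈ U_Q ↔ x = 0`, `e p ∈ U_{Q′} ↔ y = 0`, `e p ∈ U_{α₁} ↔ y = z = 0`, `e p ∈ U_{α₂} ↔ x = z = 0`. [cite: BernsteinZelevinsky1977, §2.1] -/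
theorem coord_mem_iff (p : (F × F) × F) :
    (((e p : ↥(unipotentRadicalGL F (id : Fin 3 → Fin 3))) : GL (Fin 3) F) ∈ unipotentRadicalGL F (![false, false, true] : Fin 3 → Bool) ↔ p.1.1 = 0) ∧
    (((e p : ↥(unipotentRadicalGL F (id : Fin 3 → Fin 3))) : GL (Fin 3) F) ∈ unipotentRadicalGL F (![false, true, true] : Fin 3 → Bool) ↔ p.1.2 = 0) ∧
    (((e p : ↥(unipotentRadicalGL F (id : Fin 3 → Fin 3))) : GL (Fin 3) F) ∈ unipotentRadicalGL F (![false, true, true] : Fin 3 → Bool) ⊓ standardLeviGL F (![false, false, true] : Fin 3 → Bool) ↔ p.1.2 = 0 ∧ p.2 = 0) ∧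
    (((e p : ↥(unipotentRadicalGL F (id : Fin 3 → Fin 3))) : GL (Fin 3) F) ∈ unipotentRadicalGL F (![false, false, true] : Fin 3 → Bool) ⊓ standardLeviGL F (![false, true, true] : Fin 3 → Bool) ↔ p.1.1 = 0 ∧ p.2 = 0) := by
  have hU : (((e p : ↥(unipotentRadicalGL F (id : Fin 3 → Fin 3))) : GL (Fin 3) F)) ∈ upperUnitriangular (Fin 3) F := (e p).2
  obtain ⟨h1, h2, h3⟩ := coord_apply e he p
  rw [mem_unipotentRadicalGL_twoOne_iff, mem_unipotentRadicalGL_oneTwo_iff, mem_rootGroup_zeroOne_iff, mem_rootGroup_oneTwo_iff, h1, h2, h3]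
  simp only [hU, true_and]

end Coord

/-! ## §3 The six cell data -/

section Cells

variable [TopologicalSpace F] [IsTopologicalRing F]

omit [TopologicalSpace F] [IsTopologicalRing F] in
/-- `U_Q, U_{Q′}, U_{α₁}, U_{α₂} ≤ U`. [cite: BernsteinZelevinsky1977, §2.1] -/
theorem rootSubgroups_le :
    unipotentRadicalGL F (![false, false, true] : Fin 3 → Bool) ≤ upperUnitriangular (Fin 3) F ∧
    unipotentRadicalGL F (![false, true, true] : Fin 3 → Bool) ≤ upperUnitriangular (Fin 3) F ∧
    unipotentRadicalGL F (![false, true, true] : Fin 3 → Bool) ⊓ standardLeviGL F (![false, false, true] : Fin 3 → Bool) ≤ upperUnitriangular (Fin 3) F ∧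
    unipotentRadicalGL F (![false, false, true] : Fin 3 → Bool) ⊓ standardLeviGL F (![false, true, true] : Fin 3 → Bool) ≤ upperUnitriangular (Fin 3) F :=
  ⟨fun g hg => ((mem_unipotentRadicalGL_twoOne_iff g).1 hg).1, fun g hg => ((mem_unipotentRadicalGL_oneTwo_iff g).1 hg).1,
    fun g hg => ((mem_rootGroup_zeroOne_iff g).1 hg).1, fun g hg => ((mem_rootGroup_oneTwo_iff g).1 hg).1⟩

/-- **Cell `s₁ = (0 1)`**: `Γ = U_{α₁}`, `S = U_Q`: `P_{s₁} Γ P_{s₁}⁻¹ ⊆ U⁻`; `u ∈ U, P u P⁻¹ ∈ B ⇒ u ∈ S`; `P S P⁻¹ ⊆ B`; `U = S Γ`.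
[cite: BernsteinZelevinsky1977, Thm. 5.2] [cite: Casselman1995, §6.3, Prop. 6.3.3] -/
theorem cellDatum_swap_zero_one :
    (∀ γ ∈ unipotentRadicalGL F (![false, true, true] : Fin 3 → Bool) ⊓ standardLeviGL F (![false, false, true] : Fin 3 → Bool),
        (permGL (Equiv.swap (0 : Fin 3) 1) : GL (Fin 3) F) * γ * (permGL (Equiv.swap (0 : Fin 3) 1))⁻¹ ∈ unipotentRadicalGL F (⇑OrderDual.toDual ∘ (id : Fin 3 → Fin 3))) ∧
    (∀ u ∈ upperUnitriangular (Fin 3) F, (permGL (Equiv.swap (0 : Fin 3) 1) : GL (Fin 3) F) * u * (permGL (Equiv.swap (0 : Fin 3) 1))⁻¹ ∈ standardParabolicGL F (id : Fin 3 → Fin 3) →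
        u ∈ unipotentRadicalGL F (![false, false, true] : Fin 3 → Bool)) ∧
    (∀ s ∈ unipotentRadicalGL F (![false, false, true] : Fin 3 → Bool),
        (permGL (Equiv.swap (0 : Fin 3) 1) : GL (Fin 3) F) * s * (permGL (Equiv.swap (0 : Fin 3) 1))⁻¹ ∈ standardParabolicGL F (id : Fin 3 → Fin 3)) ∧
    (∀ u ∈ upperUnitriangular (Fin 3) F, ∃ s ∈ unipotentRadicalGL F (![false, false, true] : Fin 3 → Bool),
        ∃ γ ∈ unipotentRadicalGL F (![false, true, true] : Fin 3 → Bool) ⊓ standardLeviGL F (![false, false, true] : Fin 3 → Bool), u = s * γ) := by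
  have hw0 : Equiv.swap (0 : Fin 3) 1 0 = 1 := by decide
  have hw1 : Equiv.swap (0 : Fin 3) 1 1 = 0 := by decide
  have hw2 : Equiv.swap (0 : Fin 3) 1 2 = 2 := by decide
  refine ⟨fun γ hγ => ?_, fun u hu hB => ?_, fun s hs => ?_, fun u hu => ?_⟩
  · obtain ⟨hU, h12, h02⟩ := (mem_rootGroup_zeroOne_iff γ).1 hγ
    obtain ⟨h10, h20, h21, h00, h11, h22⟩ := (mem_upperUnitriangular_three_iff γ).1 hU
    rw [mem_lowerUnitriangular_three_iff]
    simp only [permGL_conj_apply, hw0, hw1, hw2]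
    exact ⟨h10, h12, h02, h11, h00, h22⟩
  · obtain ⟨h10', h20', h21'⟩ := (mem_borel_three_iff _).1 hB
    simp only [permGL_conj_apply, hw0, hw1, hw2] at h10' h20' h21'
    exact (mem_unipotentRadicalGL_twoOne_iff u).2 ⟨hu, h10'⟩
  · obtain ⟨hU, h01⟩ := (mem_unipotentRadicalGL_twoOne_iff s).1 hs
    obtain ⟨h10, h20, h21, h00, h11, h22⟩ := (mem_upperUnitriangular_three_iff s).1 hU
    rw [mem_borel_three_iff]
    simp only [permGL_conj_apply, hw0, hw1, hw2]
    exact ⟨h01, h21, h20⟩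
  · obtain ⟨e, he⟩ := exists_coordHomeomorph (R := F)
    have hc := coord_mem_iff e he
    refine ⟨_, (hc ((0, ((u : Matrix (Fin 3) (Fin 3) F) 1 2)), (u : Matrix (Fin 3) (Fin 3) F) 0 2)).1.2 rfl,
      _, (hc (((((u : Matrix (Fin 3) (Fin 3) F) 0 1), 0), 0))).2.2.1.2 ⟨rfl, rfl⟩, ?_⟩
    rw [← Subgroup.coe_mul, coord_mul e he]
    refine (eq_coord e he u hu).trans ?_
    congr 2
    ext <;> simp

/-- **Cell `s₂ = (1 2)`**: `Γ = U_{α₂}`, `S = U_{Q′}`. [cite: BernsteinZelevinsky1977, Thm. 5.2] [cite: Casselman1995, §6.3, Prop. 6.3.3] -/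
theorem cellDatum_swap_one_two :
    (∀ γ ∈ unipotentRadicalGL F (![false, false, true] : Fin 3 → Bool) ⊓ standardLeviGL F (![false, true, true] : Fin 3 → Bool),
        (permGL (Equiv.swap (1 : Fin 3) 2) : GL (Fin 3) F) * γ * (permGL (Equiv.swap (1 : Fin 3) 2) : GL (Fin 3) F)⁻¹ ∈ unipotentRadicalGL F (⇑OrderDual.toDual ∘ (id : Fin 3 → Fin 3))) ∧
    (∀ u ∈ upperUnitriangular (Fin 3) F, (permGL (Equiv.swap (1 : Fin 3) 2) : GL (Fin 3) F) * u * (permGL (Equiv.swap (1 : Fin 3) 2) : GL (Fin 3) F)⁻¹ ∈ standardParabolicGL F (id : Fin 3 → Fin 3) →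
        u ∈ unipotentRadicalGL F (![false, true, true] : Fin 3 → Bool)) ∧
    (∀ s ∈ unipotentRadicalGL F (![false, true, true] : Fin 3 → Bool),
        (permGL (Equiv.swap (1 : Fin 3) 2) : GL (Fin 3) F) * s * (permGL (Equiv.swap (1 : Fin 3) 2) : GL (Fin 3) F)⁻¹ ∈ standardParabolicGL F (id : Fin 3 → Fin 3)) ∧
    (∀ u ∈ upperUnitriangular (Fin 3) F, ∃ s ∈ unipotentRadicalGL F (![false, true, true] : Fin 3 → Bool),
        ∃ γ ∈ unipotentRadicalGL F (![false, false, true] : Fin 3 → Bool) ⊓ standardLeviGL F (![false, true, true] : Fin 3 → Bool), u = s * γ) := by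
  have hw0 : Equiv.swap (1 : Fin 3) 2 0 = 0 := by decide
  have hw1 : Equiv.swap (1 : Fin 3) 2 1 = 2 := by decide
  have hw2 : Equiv.swap (1 : Fin 3) 2 2 = 1 := by decide
  refine ⟨fun γ hγ => ?_, fun u hu hB => ?_, fun s hs => ?_, fun u hu => ?_⟩
  · obtain ⟨hU, h01, h02⟩ := (mem_rootGroup_oneTwo_iff γ).1 hγ
    obtain ⟨h10, h20, h21, h00, h11, h22⟩ := (mem_upperUnitriangular_three_iff γ).1 hU
    rw [mem_lowerUnitriangular_three_iff]
    simp only [permGL_conj_apply, hw0, hw1, hw2]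
    exact ⟨h02, h01, h21, h00, h22, h11⟩
  · obtain ⟨h10', h20', h21'⟩ := (mem_borel_three_iff _).1 hB
    simp only [permGL_conj_apply, hw0, hw1, hw2] at h10' h20' h21'
    exact (mem_unipotentRadicalGL_oneTwo_iff u).2 ⟨hu, h21'⟩
  · obtain ⟨hU, h12⟩ := (mem_unipotentRadicalGL_oneTwo_iff s).1 hs
    obtain ⟨h10, h20, h21, h00, h11, h22⟩ := (mem_upperUnitriangular_three_iff s).1 hU
    rw [mem_borel_three_iff]
    simp only [permGL_conj_apply, hw0, hw1, hw2]
    exact ⟨h20, h10, h12⟩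
  · obtain ⟨e, he⟩ := exists_coordHomeomorph (R := F)
    have hc := coord_mem_iff e he
    refine ⟨_, (hc ((((u : Matrix (Fin 3) (Fin 3) F) 0 1), 0), (u : Matrix (Fin 3) (Fin 3) F) 0 2 - (u : Matrix (Fin 3) (Fin 3) F) 0 1 * (u : Matrix (Fin 3) (Fin 3) F) 1 2)).2.1.2 rfl,
      _, (hc (((0, ((u : Matrix (Fin 3) (Fin 3) F) 1 2)), 0))).2.2.2.2 ⟨rfl, rfl⟩, ?_⟩
    rw [← Subgroup.coe_mul, coord_mul e he]
    refine (eq_coord e he u hu).trans ?_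
    congr 2
    ext <;> simp

/-- **Cell `s₁s₂ = (0→1→2→0)`**: `Γ = U_{Q′}` (normal in `U`), `S = U_{α₂}`. [cite: BernsteinZelevinsky1977, Thm. 5.2] [cite: Casselman1995, §6.3, Prop. 6.3.3] -/
theorem cellDatum_cycle_one_two_zero :
    (∀ γ ∈ unipotentRadicalGL F (![false, true, true] : Fin 3 → Bool),
        (permGL (Equiv.swap (0 : Fin 3) 1 * Equiv.swap (1 : Fin 3) 2) : GL (Fin 3) F) * γ * (permGL (Equiv.swap (0 : Fin 3) 1 * Equiv.swap (1 : Fin 3) 2) : GL (Fin 3) F)⁻¹ ∈ unipotentRadicalGL F (⇑OrderDual.toDual ∘ (id : Fin 3 → Fin 3))) ∧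
    (∀ u ∈ upperUnitriangular (Fin 3) F, (permGL (Equiv.swap (0 : Fin 3) 1 * Equiv.swap (1 : Fin 3) 2) : GL (Fin 3) F) * u * (permGL (Equiv.swap (0 : Fin 3) 1 * Equiv.swap (1 : Fin 3) 2) : GL (Fin 3) F)⁻¹ ∈ standardParabolicGL F (id : Fin 3 → Fin 3) →
        u ∈ unipotentRadicalGL F (![false, false, true] : Fin 3 → Bool) ⊓ standardLeviGL F (![false, true, true] : Fin 3 → Bool)) ∧
    (∀ s ∈ unipotentRadicalGL F (![false, false, true] : Fin 3 → Bool) ⊓ standardLeviGL F (![false, true, true] : Fin 3 → Bool),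
        (permGL (Equiv.swap (0 : Fin 3) 1 * Equiv.swap (1 : Fin 3) 2) : GL (Fin 3) F) * s * (permGL (Equiv.swap (0 : Fin 3) 1 * Equiv.swap (1 : Fin 3) 2) : GL (Fin 3) F)⁻¹ ∈ standardParabolicGL F (id : Fin 3 → Fin 3)) ∧
    (∀ u ∈ upperUnitriangular (Fin 3) F, ∃ s ∈ unipotentRadicalGL F (![false, false, true] : Fin 3 → Bool) ⊓ standardLeviGL F (![false, true, true] : Fin 3 → Bool),
        ∃ γ ∈ unipotentRadicalGL F (![false, true, true] : Fin 3 → Bool), u = s * γ) := by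
  have hw0 : (Equiv.swap (0 : Fin 3) 1 * Equiv.swap (1 : Fin 3) 2) 0 = 1 := by decide
  have hw1 : (Equiv.swap (0 : Fin 3) 1 * Equiv.swap (1 : Fin 3) 2) 1 = 2 := by decide
  have hw2 : (Equiv.swap (0 : Fin 3) 1 * Equiv.swap (1 : Fin 3) 2) 2 = 0 := by decide
  refine ⟨fun γ hγ => ?_, fun u hu hB => ?_, fun s hs => ?_, fun u hu => ?_⟩
  · obtain ⟨hU, h12⟩ := (mem_unipotentRadicalGL_oneTwo_iff γ).1 hγ
    obtain ⟨h10, h20, h21, h00, h11, h22⟩ := (mem_upperUnitriangular_three_iff γ).1 hU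
    rw [mem_lowerUnitriangular_three_iff]
    simp only [permGL_conj_apply, hw0, hw1, hw2]
    exact ⟨h12, h10, h20, h11, h22, h00⟩
  · obtain ⟨h10', h20', h21'⟩ := (mem_borel_three_iff _).1 hB
    simp only [permGL_conj_apply, hw0, hw1, hw2] at h10' h20' h21'
    exact (mem_rootGroup_oneTwo_iff u).2 ⟨hu, h20', h21'⟩
  · obtain ⟨hU, h01, h02⟩ := (mem_rootGroup_oneTwo_iff s).1 hs
    obtain ⟨h10, h20, h21, h00, h11, h22⟩ := (mem_upperUnitriangular_three_iff s).1 hU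
    rw [mem_borel_three_iff]
    simp only [permGL_conj_apply, hw0, hw1, hw2]
    exact ⟨h21, h01, h02⟩
  · obtain ⟨e, he⟩ := exists_coordHomeomorph (R := F)
    have hc := coord_mem_iff e he
    refine ⟨_, (hc (((0, ((u : Matrix (Fin 3) (Fin 3) F) 1 2)), 0))).2.2.2.2 ⟨rfl, rfl⟩,
      _, (hc (((((u : Matrix (Fin 3) (Fin 3) F) 0 1), 0), (u : Matrix (Fin 3) (Fin 3) F) 0 2))).2.1.2 rfl, ?_⟩
    rw [← Subgroup.coe_mul, coord_mul e he]
    refine (eq_coord e he u hu).trans ?_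
    congr 2
    ext <;> simp

/-- **Cell `s₂s₁ = (0→2→1→0)`**: `Γ = U_Q` (normal in `U`), `S = U_{α₁}`. [cite: BernsteinZelevinsky1977, Thm. 5.2] [cite: Casselman1995, §6.3, Prop. 6.3.3] -/
theorem cellDatum_cycle_two_zero_one :
    (∀ γ ∈ unipotentRadicalGL F (![false, false, true] : Fin 3 → Bool),
        (permGL (Equiv.swap (1 : Fin 3) 2 * Equiv.swap (0 : Fin 3) 1) : GL (Fin 3) F) * γ * (permGL (Equiv.swap (1 : Fin 3) 2 * Equiv.swap (0 : Fin 3) 1) : GL (Fin 3) F)⁻¹ ∈ unipotentRadicalGL F (⇑OrderDual.toDual ∘ (id : Fin 3 → Fin 3))) ∧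
    (∀ u ∈ upperUnitriangular (Fin 3) F, (permGL (Equiv.swap (1 : Fin 3) 2 * Equiv.swap (0 : Fin 3) 1) : GL (Fin 3) F) * u * (permGL (Equiv.swap (1 : Fin 3) 2 * Equiv.swap (0 : Fin 3) 1) : GL (Fin 3) F)⁻¹ ∈ standardParabolicGL F (id : Fin 3 → Fin 3) →
        u ∈ unipotentRadicalGL F (![false, true, true] : Fin 3 → Bool) ⊓ standardLeviGL F (![false, false, true] : Fin 3 → Bool)) ∧
    (∀ s ∈ unipotentRadicalGL F (![false, true, true] : Fin 3 → Bool) ⊓ standardLeviGL F (![false, false, true] : Fin 3 → Bool),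
        (permGL (Equiv.swap (1 : Fin 3) 2 * Equiv.swap (0 : Fin 3) 1) : GL (Fin 3) F) * s * (permGL (Equiv.swap (1 : Fin 3) 2 * Equiv.swap (0 : Fin 3) 1) : GL (Fin 3) F)⁻¹ ∈ standardParabolicGL F (id : Fin 3 → Fin 3)) ∧
    (∀ u ∈ upperUnitriangular (Fin 3) F, ∃ s ∈ unipotentRadicalGL F (![false, true, true] : Fin 3 → Bool) ⊓ standardLeviGL F (![false, false, true] : Fin 3 → Bool),
        ∃ γ ∈ unipotentRadicalGL F (![false, false, true] : Fin 3 → Bool), u = s * γ) := by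
  have hw0 : (Equiv.swap (1 : Fin 3) 2 * Equiv.swap (0 : Fin 3) 1) 0 = 2 := by decide
  have hw1 : (Equiv.swap (1 : Fin 3) 2 * Equiv.swap (0 : Fin 3) 1) 1 = 0 := by decide
  have hw2 : (Equiv.swap (1 : Fin 3) 2 * Equiv.swap (0 : Fin 3) 1) 2 = 1 := by decide
  refine ⟨fun γ hγ => ?_, fun u hu hB => ?_, fun s hs => ?_, fun u hu => ?_⟩
  · obtain ⟨hU, h01⟩ := (mem_unipotentRadicalGL_twoOne_iff γ).1 hγ
    obtain ⟨h10, h20, h21, h00, h11, h22⟩ := (mem_upperUnitriangular_three_iff γ).1 hU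
    rw [mem_lowerUnitriangular_three_iff]
    simp only [permGL_conj_apply, hw0, hw1, hw2]
    exact ⟨h20, h21, h01, h22, h00, h11⟩
  · obtain ⟨h10', h20', h21'⟩ := (mem_borel_three_iff _).1 hB
    simp only [permGL_conj_apply, hw0, hw1, hw2] at h10' h20' h21'
    exact (mem_rootGroup_zeroOne_iff u).2 ⟨hu, h20', h10'⟩
  · obtain ⟨hU, h12, h02⟩ := (mem_rootGroup_zeroOne_iff s).1 hs
    obtain ⟨h10, h20, h21, h00, h11, h22⟩ := (mem_upperUnitriangular_three_iff s).1 hU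
    rw [mem_borel_three_iff]
    simp only [permGL_conj_apply, hw0, hw1, hw2]
    exact ⟨h02, h12, h10⟩
  · obtain ⟨e, he⟩ := exists_coordHomeomorph (R := F)
    have hc := coord_mem_iff e he
    refine ⟨_, (hc (((((u : Matrix (Fin 3) (Fin 3) F) 0 1), 0), 0))).2.2.1.2 ⟨rfl, rfl⟩,
      _, (hc (((0, ((u : Matrix (Fin 3) (Fin 3) F) 1 2)), (u : Matrix (Fin 3) (Fin 3) F) 0 2 - (u : Matrix (Fin 3) (Fin 3) F) 0 1 * (u : Matrix (Fin 3) (Fin 3) F) 1 2))).1.2 rfl, ?_⟩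
    rw [← Subgroup.coe_mul, coord_mul e he]
    refine (eq_coord e he u hu).trans ?_
    congr 2
    ext <;> simp

omit [TopologicalSpace F] [IsTopologicalRing F] in
/-- **Closed cell `w = 1`**: `Γ = 1`, `S = U`. [cite: BernsteinZelevinsky1977, Thm. 5.2] -/
theorem cellDatum_one :
    (∀ γ ∈ (⊥ : Subgroup (GL (Fin 3) F)),
        (permGL (1) : GL (Fin 3) F) * γ * (permGL (1) : GL (Fin 3) F)⁻¹ ∈ unipotentRadicalGL F (⇑OrderDual.toDual ∘ (id : Fin 3 → Fin 3))) ∧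
    (∀ u ∈ upperUnitriangular (Fin 3) F, (permGL (1) : GL (Fin 3) F) * u * (permGL (1) : GL (Fin 3) F)⁻¹ ∈ standardParabolicGL F (id : Fin 3 → Fin 3) →
        u ∈ upperUnitriangular (Fin 3) F) ∧
    (∀ s ∈ upperUnitriangular (Fin 3) F,
        (permGL (1) : GL (Fin 3) F) * s * (permGL (1) : GL (Fin 3) F)⁻¹ ∈ standardParabolicGL F (id : Fin 3 → Fin 3)) ∧
    (∀ u ∈ upperUnitriangular (Fin 3) F, ∃ s ∈ upperUnitriangular (Fin 3) F,
        ∃ γ ∈ (⊥ : Subgroup (GL (Fin 3) F)), u = s * γ) := by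
  refine ⟨fun γ hγ => ?_, fun u hu _ => hu, fun s hs => ?_, fun u hu => ⟨u, hu, 1, Subgroup.one_mem _, (mul_one u).symm⟩⟩
  · rw [Subgroup.mem_bot.1 hγ, mul_one, mul_inv_cancel]
    exact Subgroup.one_mem _
  · rw [permGL_one, one_mul, inv_one, mul_one]
    exact unipotentRadicalGL_le F (id : Fin 3 → Fin 3) hs

omit [TopologicalSpace F] [IsTopologicalRing F] in
/-- **Open cell `w₀ = rev`**: `Γ = U`, `S = 1` (`B ∩ U⁻ = 1`). [cite: BernsteinZelevinsky1977, Thm. 5.2] [cite: Casselman1995, §6.3, Prop. 6.3.3] -/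
theorem cellDatum_rev :
    (∀ γ ∈ upperUnitriangular (Fin 3) F,
        (permGL (Fin.revPerm) : GL (Fin 3) F) * γ * (permGL (Fin.revPerm) : GL (Fin 3) F)⁻¹ ∈ unipotentRadicalGL F (⇑OrderDual.toDual ∘ (id : Fin 3 → Fin 3))) ∧
    (∀ u ∈ upperUnitriangular (Fin 3) F, (permGL (Fin.revPerm) : GL (Fin 3) F) * u * (permGL (Fin.revPerm) : GL (Fin 3) F)⁻¹ ∈ standardParabolicGL F (id : Fin 3 → Fin 3) →
        u ∈ (⊥ : Subgroup (GL (Fin 3) F))) ∧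
    (∀ s ∈ (⊥ : Subgroup (GL (Fin 3) F)),
        (permGL (Fin.revPerm) : GL (Fin 3) F) * s * (permGL (Fin.revPerm) : GL (Fin 3) F)⁻¹ ∈ standardParabolicGL F (id : Fin 3 → Fin 3)) ∧
    (∀ u ∈ upperUnitriangular (Fin 3) F, ∃ s ∈ (⊥ : Subgroup (GL (Fin 3) F)),
        ∃ γ ∈ upperUnitriangular (Fin 3) F, u = s * γ) := by
  have hw0 : (Fin.revPerm : Equiv.Perm (Fin 3)) 0 = 2 := by decide
  have hw1 : (Fin.revPerm : Equiv.Perm (Fin 3)) 1 = 1 := by decide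
  have hw2 : (Fin.revPerm : Equiv.Perm (Fin 3)) 2 = 0 := by decide
  refine ⟨fun γ hγ => ?_, fun u hu hB => ?_, fun s hs => ?_, fun u hu => ⟨1, Subgroup.one_mem _, u, hu, (one_mul u).symm⟩⟩
  · obtain ⟨h10, h20, h21, h00, h11, h22⟩ := (mem_upperUnitriangular_three_iff γ).1 hγ
    rw [mem_lowerUnitriangular_three_iff]
    simp only [permGL_conj_apply, hw0, hw1, hw2]
    exact ⟨h21, h20, h10, h22, h11, h00⟩
  · obtain ⟨h10', h20', h21'⟩ := (mem_borel_three_iff _).1 hB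
    simp only [permGL_conj_apply, hw0, hw1, hw2] at h10' h20' h21'
    obtain ⟨h10, h20, h21, h00, h11, h22⟩ := (mem_upperUnitriangular_three_iff u).1 hu
    refine Subgroup.mem_bot.2 (Units.ext (Matrix.ext fun i j => ?_))
    fin_cases i <;> fin_cases j <;> simp [*]
  · rw [Subgroup.mem_bot.1 hs, mul_one, mul_inv_cancel]
    exact Subgroup.one_mem _

end Cells

end Summit.HodgeConjecture.HodgeConjecture.Cruxes.H413.K2E3GL3BruhatCellSubgroups
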